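import Summits.Ventures.HodgeRepro2.T5SU11JacobiPhaseMGF
import Summits.Ventures.HodgeRepro2.T5SU11JacobiPhaseMoments

/-!
# The phase and the orbit radius are positively correlated, for every `λ`

Under the probability measure `m_k φ_λ dν/m̂_k(λ)` the phase `s = log|a(g)|` and the squared orbit radius
`|g·0|² = 1 − e^{−2s}` are increasing functions of one another, so they should be positively correlated.
This file proves it through the weight structure of the transform: since `|g·0|² m_k = m_k − m_{k+2}`,

  **`∫_G log|a| · |g·0|² m_k φ_λ dν = M_k(λ) − M_{k+2}(λ)`**,  `M_k(λ) := ∫_G log|a| m_k φ_λ dν`   (`integral_log_mul_orbit_sq_mul_eq`),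

and with the recursion `m̂_{k+2} = r_k(λ) m̂_k` (`T5SU11JacobiWeightRecursion`) and the mean squared orbit
radius `1 − r_k(λ)` (`T5SU11JacobiPhaseMGF`) the covariance is a difference of mean phases:

  **`Cov_{k,λ}(log|a|, |g·0|²) = r_k(λ) · (⟨log|a|⟩_{k,λ} − ⟨log|a|⟩_{k+2,λ})`**   (`covariance_phase_orbit_sq_eq`).

The mean phase is ANTITONE in the weight (`mean_phase_antitone`: `−⟨log|a|⟩_{k,λ}` is the derivative of the
convex function `log m̂_·(λ)`, `T5SU11JacobiWeight.convexOn_log_jacobi_weight`, and the derivative of a convex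
function is monotone — `ConvexOn.le_slope_of_hasDerivAt` / `ConvexOn.slope_le_of_hasDerivAt`), so

  **`Cov_{k,λ}(log|a|, |g·0|²) ≥ 0`**   (`covariance_phase_orbit_sq_nonneg`)

for every real `λ` and every `k` on the ray; at `λ = 0` the covariance is exactly `2/k²`
(`covariance_phase_orbit_sq_zero`: `r_k(0) = (k − 2)/k`, `⟨log|a|⟩_{k,0} = 1/(k − 2)`). Nothing is claimed
about (N).

Blind lane: Mathlib + the HodgeRepro2 prefix only; no sorry; axioms ⊆ {propext, Classical.choice,
Quot.sound}.
-/

namespace Summit.Ventures.HodgeRepro2.T5SU11JacobiPhaseOrbitCovariance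

open MeasureTheory MeasureTheory.Measure Metric Set Filter Topology
open T5SU11Unimodular T5SU11Fibration T5SU11Cartan T5SU11CartanProjection T5HaarCircle
  T5BergmanCoefficient T5SU11FibrationHaar T5SU11SphericalFunction T5SU11SphericalSymmetry
  T5SU11SphericalBounds T5SU11SphericalContinuous T5SU11JacobiIwasawa T5SU11JacobiTransform
  T5SU11JacobiWeight T5SU11KFiniteMajorantPow T5SU11JacobiWeightDeriv T5SU11JacobiWeightRecursion
  T5SU11JacobiCompleteMonotone T5SU11JacobiPhaseMGF T5SU11JacobiPhaseMoments
open scoped Real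

section measure

variable [MeasurableSpace Circle] [BorelSpace Circle]

/-! ### The mixed moment -/

/-- **The mixed moment of the phase and the squared orbit radius**: on the ray,
`∫_G log|a| · |g·0|² m_k φ_λ dν = ∫_G log|a| m_k φ_λ dν − ∫_G log|a| m_{k+2} φ_λ dν`. -/
theorem integral_log_mul_orbit_sq_mul_eq {k lam : ℝ} (hk : 1 < k) (h1 : lam < k) (h2 : 2 < k + lam) :
    ∫ g, Real.log ‖mat g 0 0‖ * ‖orbit g‖ ^ 2 * ((1 - ‖orbit g‖ ^ 2) ^ (k / 2) * sph lam g)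
        ∂(nu haarCircle)
      = (∫ g, Real.log ‖mat g 0 0‖ * ((1 - ‖orbit g‖ ^ 2) ^ (k / 2) * sph lam g) ∂(nu haarCircle))
        - ∫ g, Real.log ‖mat g 0 0‖ * ((1 - ‖orbit g‖ ^ 2) ^ ((k + 2) / 2) * sph lam g)
          ∂(nu haarCircle) := by
  rw [← integral_sub (integrable_log_norm_mat_mul_orbit_rpow_mul_sph hk h1 h2)
    (integrable_log_norm_mat_mul_orbit_rpow_mul_sph (by linarith) (by linarith) (by linarith))]
  refine integral_congr_ae (Filter.Eventually.of_forall fun g => ?_)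
  simp only
  rw [orbit_rpow_add, show (2 : ℝ) / 2 = 1 by norm_num, Real.rpow_one]
  ring

/-! ### The mean phase is antitone in the weight -/

/-- **The mean phase is antitone in the weight**: for `k₁ ≤ k₂` on the ray,
`⟨log|a|⟩_{k₂,λ} ≤ ⟨log|a|⟩_{k₁,λ}` — the derivative `−⟨log|a|⟩_{k,λ}` of the convex function `log m̂_·(λ)`
is monotone. -/
theorem mean_phase_antitone {k₁ k₂ lam : ℝ} (hk : 1 < k₁) (h1 : lam < k₁) (h2 : 2 < k₁ + lam)
    (hle : k₁ ≤ k₂) :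
    (∫ g, Real.log ‖mat g 0 0‖ * ((1 - ‖orbit g‖ ^ 2) ^ (k₂ / 2) * sph lam g) ∂(nu haarCircle))
        / ∫ g, (1 - ‖orbit g‖ ^ 2) ^ (k₂ / 2) * sph lam g ∂(nu haarCircle)
      ≤ (∫ g, Real.log ‖mat g 0 0‖ * ((1 - ‖orbit g‖ ^ 2) ^ (k₁ / 2) * sph lam g) ∂(nu haarCircle))
        / ∫ g, (1 - ‖orbit g‖ ^ 2) ^ (k₁ / 2) * sph lam g ∂(nu haarCircle) := by
  rcases eq_or_lt_of_le hle with rfl | hlt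
  · exact le_rfl
  have hS₁ : k₁ ∈ Ioi (max 1 (max lam (2 - lam))) := by
    rw [mem_Ioi, max_lt_iff, max_lt_iff]
    exact ⟨hk, h1, by linarith⟩
  have hS₂ : k₂ ∈ Ioi (max 1 (max lam (2 - lam))) := by
    rw [mem_Ioi, max_lt_iff, max_lt_iff]
    exact ⟨by linarith, by linarith, by linarith⟩
  have hd₁ := hasDerivAt_log_jacobi_weight hk h1 h2
  have hd₂ := hasDerivAt_log_jacobi_weight (k := k₂) (lam := lam) (by linarith) (by linarith)
    (by linarith)
  have hA := (convexOn_log_jacobi_weight lam).le_slope_of_hasDerivAt hS₁ hS₂ hlt hd₁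
  have hB := (convexOn_log_jacobi_weight lam).slope_le_of_hasDerivAt hS₁ hS₂ hlt hd₂
  have h := hA.trans hB
  rw [neg_div, neg_div, neg_le_neg_iff] at h
  exact h

/-! ### The covariance -/

/-- **THE COVARIANCE OF THE PHASE AND THE SQUARED ORBIT RADIUS** is a difference of mean phases: on the ray,
`⟨log|a| · |g·0|²⟩_{k,λ} − ⟨log|a|⟩_{k,λ} ⟨|g·0|²⟩_{k,λ} = r_k(λ) (⟨log|a|⟩_{k,λ} − ⟨log|a|⟩_{k+2,λ})`. -/
theorem covariance_phase_orbit_sq_eq {k lam : ℝ} (hk : 1 < k) (h1 : lam < k) (h2 : 2 < k + lam) :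
    (∫ g, Real.log ‖mat g 0 0‖ * ‖orbit g‖ ^ 2 * ((1 - ‖orbit g‖ ^ 2) ^ (k / 2) * sph lam g)
          ∂(nu haarCircle))
        / (∫ g, (1 - ‖orbit g‖ ^ 2) ^ (k / 2) * sph lam g ∂(nu haarCircle))
      - ((∫ g, Real.log ‖mat g 0 0‖ * ((1 - ‖orbit g‖ ^ 2) ^ (k / 2) * sph lam g) ∂(nu haarCircle))
          / (∫ g, (1 - ‖orbit g‖ ^ 2) ^ (k / 2) * sph lam g ∂(nu haarCircle)))
        * ((∫ g, ‖orbit g‖ ^ 2 * ((1 - ‖orbit g‖ ^ 2) ^ (k / 2) * sph lam g) ∂(nu haarCircle))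
          / (∫ g, (1 - ‖orbit g‖ ^ 2) ^ (k / 2) * sph lam g ∂(nu haarCircle)))
      = weightRatio k lam
        * ((∫ g, Real.log ‖mat g 0 0‖ * ((1 - ‖orbit g‖ ^ 2) ^ (k / 2) * sph lam g) ∂(nu haarCircle))
            / (∫ g, (1 - ‖orbit g‖ ^ 2) ^ (k / 2) * sph lam g ∂(nu haarCircle))
          - (∫ g, Real.log ‖mat g 0 0‖ * ((1 - ‖orbit g‖ ^ 2) ^ ((k + 2) / 2) * sph lam g)
              ∂(nu haarCircle))
            / (∫ g, (1 - ‖orbit g‖ ^ 2) ^ ((k + 2) / 2) * sph lam g ∂(nu haarCircle))) := by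
  have hpos := jacobi_pos hk h1 h2
  have hr := weightRatio_pos h1 h2
  rw [integral_log_mul_orbit_sq_mul_eq hk h1 h2, mean_orbit_sq_eq hk h1 h2,
    jacobi_weight_add_two hk h1 h2]
  field_simp
  ring

/-- **THE PHASE AND THE ORBIT RADIUS ARE POSITIVELY CORRELATED**: on the ray, for every `λ`,
`Cov_{k,λ}(log|a|, |g·0|²) ≥ 0`. -/
theorem covariance_phase_orbit_sq_nonneg {k lam : ℝ} (hk : 1 < k) (h1 : lam < k) (h2 : 2 < k + lam) :
    0 ≤ (∫ g, Real.log ‖mat g 0 0‖ * ‖orbit g‖ ^ 2 * ((1 - ‖orbit g‖ ^ 2) ^ (k / 2) * sph lam g)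
          ∂(nu haarCircle))
        / (∫ g, (1 - ‖orbit g‖ ^ 2) ^ (k / 2) * sph lam g ∂(nu haarCircle))
      - ((∫ g, Real.log ‖mat g 0 0‖ * ((1 - ‖orbit g‖ ^ 2) ^ (k / 2) * sph lam g) ∂(nu haarCircle))
          / (∫ g, (1 - ‖orbit g‖ ^ 2) ^ (k / 2) * sph lam g ∂(nu haarCircle)))
        * ((∫ g, ‖orbit g‖ ^ 2 * ((1 - ‖orbit g‖ ^ 2) ^ (k / 2) * sph lam g) ∂(nu haarCircle))
          / (∫ g, (1 - ‖orbit g‖ ^ 2) ^ (k / 2) * sph lam g ∂(nu haarCircle))) := by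
  rw [covariance_phase_orbit_sq_eq hk h1 h2]
  exact mul_nonneg (weightRatio_pos h1 h2).le
    (sub_nonneg.mpr (mean_phase_antitone hk h1 h2 (by linarith)))

/-- **At `λ = 0` the covariance is `2/k²`**: `r_k(0) = (k − 2)/k` and `⟨log|a|⟩_{k,0} = 1/(k − 2)`. -/
theorem covariance_phase_orbit_sq_zero {k : ℝ} (hk : 2 < k) :
    (∫ g, Real.log ‖mat g 0 0‖ * ‖orbit g‖ ^ 2 * ((1 - ‖orbit g‖ ^ 2) ^ (k / 2) * sph 0 g)
          ∂(nu haarCircle))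
        / (∫ g, (1 - ‖orbit g‖ ^ 2) ^ (k / 2) * sph 0 g ∂(nu haarCircle))
      - ((∫ g, Real.log ‖mat g 0 0‖ * ((1 - ‖orbit g‖ ^ 2) ^ (k / 2) * sph 0 g) ∂(nu haarCircle))
          / (∫ g, (1 - ‖orbit g‖ ^ 2) ^ (k / 2) * sph 0 g ∂(nu haarCircle)))
        * ((∫ g, ‖orbit g‖ ^ 2 * ((1 - ‖orbit g‖ ^ 2) ^ (k / 2) * sph 0 g) ∂(nu haarCircle))
          / (∫ g, (1 - ‖orbit g‖ ^ 2) ^ (k / 2) * sph 0 g ∂(nu haarCircle)))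
      = 2 / k ^ 2 := by
  rw [covariance_phase_orbit_sq_eq (by linarith) (by linarith) (by linarith),
    integral_log_norm_mat_mul_orbit_rpow_mul_sph_zero hk,
    integral_log_norm_mat_mul_orbit_rpow_mul_sph_zero (by linarith : 2 < k + 2),
    integral_orbit_rpow_mul_sph_zero hk, integral_orbit_rpow_mul_sph_zero (by linarith : 2 < k + 2)]
  simp only [weightRatio, sub_zero, add_zero, add_sub_cancel_right]
  have hk0 : k ≠ 0 := by linarith
  have hk2 : k - 2 ≠ 0 := by
    intro h
    linarith
  have hpi : (π : ℝ) ≠ 0 := Real.pi_ne_zero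
  field_simp
  ring

end measure

end Summit.Ventures.HodgeRepro2.T5SU11JacobiPhaseOrbitCovariance
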